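import Summits.HodgeConjecture.HodgeConjecture.Theorems.F0P3cStCharTSShellOrbitalGSupport   -- ★ p849885 (this seat) «S-SHELL»: `shellTorusSet_spec`; brings ★ p849763 Ψ-producer
import Summits.HodgeConjecture.HodgeConjecture.Theorems.F0P3cStCharTSDeltaAtLevi            -- ★ (LH6-p04) `formCongr_one_qsForm`: the identity frame on `U(Φ₃)(L⁺_v)`
import Literature.NumberTheory.Rogawski1990.CMLocalAPacketMembers                       -- ★ `qsForm`
import HarnessLib

/-!
# F0 · P3c · line LH6 «StCharTS» — road (D), brick D3-ii «OCAN-SHELL»: the Ψ-producer INSTANCE at the identity frame for the shell indicator `𝟙_{K b K}`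
# on the quasi-split group `U(Φ₃)(L⁺_v) = (cmDatum L 3 (qsForm L)).Local v`

Cell `pub/hodgecm-mathlib`, crux H413 = `stmt-HodgeConjecture-24833` (lane `--supports … --as helper`); seat LH2-p03 (g3); road (D) owner LH6-p03 (g0) ∕ LH6-p04 (g3),
dealer F0P3b-plan (g23); asked for by LH6-p05 (g2) (bus 06:33:21Z, «OCAN-SHELL★»).  THEOREMS ONLY, sorry-free, ★-only imports.  HONEST LABEL: HC_CM is proved only
modulo the 7 printed citations (2 remaining: hLiu418 = stmt-HodgeConjecture-24832, h413 = stmt-HodgeConjecture-24833) until rung 0 closes; count-neutral.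

THE MATHEMATICS ([Rogawski1990, §4.9 pp. 55–56; §12.7 L. 12.7.3 (proof) p. 195]).  ★ p849763 `exists_normalizedOrbitalIntegral_isLocallyConstant_hasCompactSupport` produces
the locally constant compactly supported `Ψ(t) = δ_B^{1/2}(t)·J₃(t,d)⁻¹·O_{⟦e t⟧}(f)` from a compact `S ⊆ M` with `hSreg ∕ hSunit ∕ hSoff`; ★ p849885 `shellTorusSet_spec`
supplies that `S` for `f = 𝟙_{KbK}` (`b = diag(d) ∈ M` dominant: `|d₀|_w < |d₁|_w < |d₂|_w`; `K` compact open, `|k_ij − δ_ij|_w ≤ r < 1` on `K`).  Here the two are composed at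
the IDENTITY FRAME `H := Φ₃ = qsForm L`, `T := 1`, `a := 1` (★ `formCongr_one_qsForm`), where `e₁ g = g` (§1), in both printings of the class: `⟦e₁ t⟧` (the token of
★ p849750 `hlevi_of_closed_forms`'s `hOG`) and `⟦t⟧` (the token of ★ p849878 `hshell_of_psi`'s `hΨpt`).

## References
* [Rogawski1990] J. D. Rogawski, *Automorphic Representations of Unitary Groups in Three Variables*, Ann. of Math. Stud. 123 (1990), §4.9 pp. 55–56; §12.7 L. 12.7.3 (proof)
  p. 195; §12.2 p. 173.
-/

set_option autoImplicit false
set_option linter.dupNamespace false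

noncomputable section

open NumberField IsDedekindDomain MeasureTheory Topology Filter Set
open scoped Matrix MatrixGroups NNReal
open Literature.MeasureTheory.Group Literature.NumberTheory.Automorphic Literature.NumberTheory.Automorphic.UnitaryGroup
open Literature.NumberTheory.Rogawski1990

namespace Summit.HodgeConjecture.HodgeConjecture.Cruxes.H413.F0P3cStCharTSShellOrbitalG

variable (L : Type) [Field L] [NumberField L] [IsCMField L]

/-! ## §1 The identity frame and the form `Φ₃` -/

/-- `Φ₃` is hermitian: `(σΦ₃)ᵀ = Φ₃` (its entries are `0, 1`). [cite: Rogawski1990, §12.2 p. 173] -/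
theorem qsForm_map_transpose : ((qsForm L).map (IsCMField.complexConj L))ᵀ = qsForm L := by
  ext i j
  simp only [qsForm, Matrix.transpose_apply, Matrix.map_apply, Matrix.of_apply, apply_ite, map_one, map_zero]
  simp_rw [Nat.add_comm (j : ℕ) (i : ℕ)]
  split_ifs <;> rfl

omit [NumberField L] [IsCMField L] in
/-- `det Φ₃` is a unit (`= −1`). [cite: Rogawski1990, §12.2 p. 173] -/
theorem isUnit_det_qsForm : IsUnit (qsForm L).det := by
  have h : (qsForm L).det = -1 := by
    rw [Matrix.det_fin_three]
    simp [qsForm, Matrix.of_apply]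
  rw [h]
  exact isUnit_one.neg

/-- **The identity frame is the identity**: `e₁ g = g` for `e₁ = cmDatumLocalCongr L v 1 isUnit_one formCongr_one_qsForm` (its matrix is `1·g·1⁻¹`, ★ `coe_cmDatumLocalCongr_apply`).
[cite: Rogawski1990, §4.9 p. 55] -/
theorem cmDatumLocalCongr_one_apply (v : HeightOneSpectrum (𝓞 ↥(maximalRealSubfield L))) (g : ↥(unitaryGroupOfForm (conjLocal L (IsCMField.complexConj L) v) (cmLocalForm L 3 v))) :
    (cmDatumLocalCongr L v (1 : GL (Fin 3) (LocalRing L v)) isUnit_one (F0P3cStCharTSDeltaAtLevi.formCongr_one_qsForm L v)) g = g := by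
  apply Subtype.ext
  apply Units.ext
  change ((1 : GL (Fin 3) (LocalRing L v)) * (g : GL (Fin 3) (LocalRing L v)) * (1 : GL (Fin 3) (LocalRing L v))⁻¹).val = (g : GL (Fin 3) (LocalRing L v)).val
  rw [inv_one, mul_one, one_mul]

/-! ## §2 «OCAN-SHELL» -/

set_option maxHeartbeats 3200000 in
set_option synthInstance.maxHeartbeats 400000 in
/-- **«OCAN-SHELL» (token `⟦e₁ t⟧`).**  On `U(Φ₃)(L⁺_v) = (cmDatum L 3 (qsForm L)).Local v` with a Haar measure `ν_G` and a CANONICAL family `m_G`: for `K ≤ U(Φ₃)` compact open with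
`|k_ij − δ_ij|_w ≤ r < 1` on `K` and `b = diag(d) ∈ M` with `|d₀|_w < |d₁|_w < |d₂|_w`, there is `Ψ : M → ℂ`, LOCALLY CONSTANT and COMPACTLY SUPPORTED, with
`Ψ(t) = δ_B^{1/2}(t) · J₃(t,d′)⁻¹ · O_{⟦e₁ t⟧}(𝟙_{KbK})` for every `t ∈ M` and every diagonal writing `d′` of `t` at which `J₃` is defined — the data `Ψ hΨlc hΨK hΨ∕hpt` of ★ p849606 and
the `Φ_G`∕`hOG` input of ★ p849750 for the shell indicator. [cite: Rogawski1990, §4.9 pp. 55–56; §12.7 L. 12.7.3 (proof) p. 195] -/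
theorem exists_normalizedOrbitalIntegral_indicator_shell {v : HeightOneSpectrum (𝓞 ↥(maximalRealSubfield L))} (w : PlacesOver L v) (hw : IsCMField.complexConj L • w.1 = w.1)
    [MeasurableSpace ((cmDatum L 3 (qsForm L)).Local v)] [BorelSpace ((cmDatum L 3 (qsForm L)).Local v)]
    [∀ γ : ((cmDatum L 3 (qsForm L)).Local v), MeasurableSpace (((cmDatum L 3 (qsForm L)).Local v) ⧸ Subgroup.centralizer ({γ} : Set ((cmDatum L 3 (qsForm L)).Local v)))]
    [∀ γ : ((cmDatum L 3 (qsForm L)).Local v), BorelSpace (((cmDatum L 3 (qsForm L)).Local v) ⧸ Subgroup.centralizer ({γ} : Set ((cmDatum L 3 (qsForm L)).Local v)))]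
    (νG : Measure ((cmDatum L 3 (qsForm L)).Local v)) [νG.IsHaarMeasure] [νG.IsMulRightInvariant]
    {mG : OrbitalMeasureFamily ((cmDatum L 3 (qsForm L)).Local v)}
    (hmG : mG.IsCanonical (fun γ => IsRegularElt (γ.val : GL (Fin 3) (LocalRing L v))) νG)
    (K : Subgroup ↥(unitaryGroupOfForm (conjLocal L (IsCMField.complexConj L) v) (cmLocalForm L 3 v))) (hKo : IsOpen (K : Set ↥(unitaryGroupOfForm (conjLocal L (IsCMField.complexConj L) v) (cmLocalForm L 3 v)))) (hKc : IsCompact (K : Set ↥(unitaryGroupOfForm (conjLocal L (IsCMField.complexConj L) v) (cmLocalForm L 3 v)))) {r : WithZero (Multiplicative ℤ)} (hr : r < 1)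
    (hKr : ∀ k ∈ K, ∀ i j : Fin 3, Valued.v ((((k : GL (Fin 3) (LocalRing L v)).val i j - (1 : Matrix (Fin 3) (Fin 3) (LocalRing L v)) i j) : LocalRing L v) w) ≤ r)
    {b : ↥(unitaryGroupOfForm (conjLocal L (IsCMField.complexConj L) v) (cmLocalForm L 3 v))} (hbM : b ∈ (cmBorelTriple L 3 v).M) {d : Fin 3 → (LocalRing L v)ˣ} (hd : glDiagonal 3 (LocalRing L v) d = (b : GL (Fin 3) (LocalRing L v)))
    (h01 : Valued.v ((((d 0 : (LocalRing L v)ˣ) : LocalRing L v) : LocalRing L v) w) < Valued.v ((((d 1 : (LocalRing L v)ˣ) : LocalRing L v) : LocalRing L v) w)) (h12 : Valued.v ((((d 1 : (LocalRing L v)ˣ) : LocalRing L v) : LocalRing L v) w) < Valued.v ((((d 2 : (LocalRing L v)ˣ) : LocalRing L v) : LocalRing L v) w)) :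
    haveI := locallyCompactSpace_cmBorelU L 3 v
    ∃ Ψ : ↥(cmBorelTriple L 3 v).M → ℂ, IsLocallyConstant Ψ ∧ HasCompactSupport Ψ ∧
      ∀ (t : ↥(cmBorelTriple L 3 v).M) (d' : Fin 3 → (LocalRing L v)ˣ)
      (hd' : glDiagonal 3 (LocalRing L v) d' = ((t : ↥(unitaryGroupOfForm (conjLocal L (IsCMField.complexConj L) v) (cmLocalForm L 3 v))) : GL (Fin 3) (LocalRing L v)))
      (ha' : IsUnit ((((d' 0)⁻¹ * d' 1 : (LocalRing L v)ˣ) : LocalRing L v) - 1))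
      (hb' : IsUnit ((((d' 0)⁻¹ * d' 2 : (LocalRing L v)ˣ) : LocalRing L v) - 1)),
      Ψ t =
          ((rootDeltaChar (cmBorelTriple L 3 v).P ⟨(t : ↥(unitaryGroupOfForm (conjLocal L (IsCMField.complexConj L) v) (cmLocalForm L 3 v))), (cmBorelTriple L 3 v).M_le t.2⟩ : ℂˣ) : ℂ) *
        (((letI : MeasurableSpace (LocalRing L v) := borel _; haveI : BorelSpace (LocalRing L v) := ⟨rfl⟩
          haveI : SecondCountableTopology (LocalRing L v) := secondCountableTopology_localRing (E := L) v
          ((distribHaarChar (LocalRing L v) ha'.unit)⁻¹ *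
            (HeisRing.skewModulus (conjLocal L (IsCMField.complexConj L) v) (continuous_conjLocal L (IsCMField.complexConj L) v) hb'.unit
              (HeisRing.map_unit_torusCentralScalar_sub_one (conjLocal L (IsCMField.complexConj L) v) (cmLocalForm_eq_over L 3 v) t hd' hb'))⁻¹ : ℝ≥0)) : ℝ) : ℂ)⁻¹ *
        classOrbitalIntegral mG ((DoubleCoset.doubleCoset b (K : Set ↥(unitaryGroupOfForm (conjLocal L (IsCMField.complexConj L) v) (cmLocalForm L 3 v))) (K : Set ↥(unitaryGroupOfForm (conjLocal L (IsCMField.complexConj L) v) (cmLocalForm L 3 v)))).indicator fun _ => (1 : ℂ)) (ConjClasses.mk ((cmDatumLocalCongr L v (1 : GL (Fin 3) (LocalRing L v)) isUnit_one (F0P3cStCharTSDeltaAtLevi.formCongr_one_qsForm L v)) (t : ↥(unitaryGroupOfForm (conjLocal L (IsCMField.complexConj L) v) (cmLocalForm L 3 v))))) := by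
  haveI := locallyCompactSpace_cmBorelU L 3 v
  obtain ⟨hSc, hSreg, hSunit, -, hSoffF⟩ := shellTorusSet_spec L (qsForm L) w hw (1 : GL (Fin 3) (LocalRing L v)) isUnit_one
    (F0P3cStCharTSDeltaAtLevi.formCongr_one_qsForm L v) K hKc hr hKr hbM hd h01 h12
  -- the shell is compact open, so its indicator is `C_c^∞`
  have hDo : IsOpen (DoubleCoset.doubleCoset b (K : Set ↥(unitaryGroupOfForm (conjLocal L (IsCMField.complexConj L) v) (cmLocalForm L 3 v))) (K : Set ↥(unitaryGroupOfForm (conjLocal L (IsCMField.complexConj L) v) (cmLocalForm L 3 v)))) := hKo.mul_left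
  have hDc : IsCompact (DoubleCoset.doubleCoset b (K : Set ↥(unitaryGroupOfForm (conjLocal L (IsCMField.complexConj L) v) (cmLocalForm L 3 v))) (K : Set ↥(unitaryGroupOfForm (conjLocal L (IsCMField.complexConj L) v) (cmLocalForm L 3 v)))) := (hKc.mul isCompact_singleton).mul hKc
  have hf : IsLocSmooth (X := ((cmDatum L 3 (qsForm L)).Local v)) ((DoubleCoset.doubleCoset b (K : Set ↥(unitaryGroupOfForm (conjLocal L (IsCMField.complexConj L) v) (cmLocalForm L 3 v))) (K : Set ↥(unitaryGroupOfForm (conjLocal L (IsCMField.complexConj L) v) (cmLocalForm L 3 v)))).indicator fun _ => (1 : ℂ)) := isLocSmooth_indicator hDo hDc.isClosed hDc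
  -- `tsupport 𝟙_{KbK} ⊆ e₁(KbK)` since `e₁ = id`
  have hF : tsupport ((((DoubleCoset.doubleCoset b (K : Set ↥(unitaryGroupOfForm (conjLocal L (IsCMField.complexConj L) v) (cmLocalForm L 3 v))) (K : Set ↥(unitaryGroupOfForm (conjLocal L (IsCMField.complexConj L) v) (cmLocalForm L 3 v)))).indicator fun _ => (1 : ℂ)) : ((cmDatum L 3 (qsForm L)).Local v) → ℂ)) ⊆ (cmDatumLocalCongr L v (1 : GL (Fin 3) (LocalRing L v)) isUnit_one (F0P3cStCharTSDeltaAtLevi.formCongr_one_qsForm L v)) '' DoubleCoset.doubleCoset b (K : Set ↥(unitaryGroupOfForm (conjLocal L (IsCMField.complexConj L) v) (cmLocalForm L 3 v))) (K : Set ↥(unitaryGroupOfForm (conjLocal L (IsCMField.complexConj L) v) (cmLocalForm L 3 v))) := by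
    intro y hy
    have hy' : y ∈ DoubleCoset.doubleCoset b (K : Set ↥(unitaryGroupOfForm (conjLocal L (IsCMField.complexConj L) v) (cmLocalForm L 3 v))) (K : Set ↥(unitaryGroupOfForm (conjLocal L (IsCMField.complexConj L) v) (cmLocalForm L 3 v))) := by
      have hsub : tsupport ((((DoubleCoset.doubleCoset b (K : Set ↥(unitaryGroupOfForm (conjLocal L (IsCMField.complexConj L) v) (cmLocalForm L 3 v))) (K : Set ↥(unitaryGroupOfForm (conjLocal L (IsCMField.complexConj L) v) (cmLocalForm L 3 v)))).indicator fun _ => (1 : ℂ)) : ((cmDatum L 3 (qsForm L)).Local v) → ℂ)) ⊆ DoubleCoset.doubleCoset b (K : Set ↥(unitaryGroupOfForm (conjLocal L (IsCMField.complexConj L) v) (cmLocalForm L 3 v))) (K : Set ↥(unitaryGroupOfForm (conjLocal L (IsCMField.complexConj L) v) (cmLocalForm L 3 v))) := by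
        rw [tsupport]; exact closure_minimal Set.support_indicator_subset hDc.isClosed
      exact hsub hy
    exact ⟨y, hy', cmDatumLocalCongr_one_apply L v y⟩
  exact exists_normalizedOrbitalIntegral_isLocallyConstant_hasCompactSupport L (qsForm L) (qsForm_map_transpose L) (isUnit_det_qsForm L) w hw
    (1 : GL (Fin 3) (LocalRing L v)) isUnit_one (F0P3cStCharTSDeltaAtLevi.formCongr_one_qsForm L v) νG hmG hf _ hSc hSreg hSunit
    (hSoffF _ hF)

set_option maxHeartbeats 3200000 in
set_option synthInstance.maxHeartbeats 400000 in
/-- **«OCAN-SHELL» (token `⟦t⟧`)** — the same with the class printed `ConjClasses.mk t` (`e₁ t = t`, §1): the shape `hΨpt` of ★ p849878 `hshell_of_psi`.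
[cite: Rogawski1990, §4.9 pp. 55–56; §12.7 L. 12.7.3 (proof) p. 195] -/
theorem exists_normalizedOrbitalIntegral_indicator_shell' {v : HeightOneSpectrum (𝓞 ↥(maximalRealSubfield L))} (w : PlacesOver L v) (hw : IsCMField.complexConj L • w.1 = w.1)
    [MeasurableSpace ((cmDatum L 3 (qsForm L)).Local v)] [BorelSpace ((cmDatum L 3 (qsForm L)).Local v)]
    [∀ γ : ((cmDatum L 3 (qsForm L)).Local v), MeasurableSpace (((cmDatum L 3 (qsForm L)).Local v) ⧸ Subgroup.centralizer ({γ} : Set ((cmDatum L 3 (qsForm L)).Local v)))]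
    [∀ γ : ((cmDatum L 3 (qsForm L)).Local v), BorelSpace (((cmDatum L 3 (qsForm L)).Local v) ⧸ Subgroup.centralizer ({γ} : Set ((cmDatum L 3 (qsForm L)).Local v)))]
    (νG : Measure ((cmDatum L 3 (qsForm L)).Local v)) [νG.IsHaarMeasure] [νG.IsMulRightInvariant]
    {mG : OrbitalMeasureFamily ((cmDatum L 3 (qsForm L)).Local v)}
    (hmG : mG.IsCanonical (fun γ => IsRegularElt (γ.val : GL (Fin 3) (LocalRing L v))) νG)
    (K : Subgroup ↥(unitaryGroupOfForm (conjLocal L (IsCMField.complexConj L) v) (cmLocalForm L 3 v))) (hKo : IsOpen (K : Set ↥(unitaryGroupOfForm (conjLocal L (IsCMField.complexConj L) v) (cmLocalForm L 3 v)))) (hKc : IsCompact (K : Set ↥(unitaryGroupOfForm (conjLocal L (IsCMField.complexConj L) v) (cmLocalForm L 3 v)))) {r : WithZero (Multiplicative ℤ)} (hr : r < 1)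
    (hKr : ∀ k ∈ K, ∀ i j : Fin 3, Valued.v ((((k : GL (Fin 3) (LocalRing L v)).val i j - (1 : Matrix (Fin 3) (Fin 3) (LocalRing L v)) i j) : LocalRing L v) w) ≤ r)
    {b : ↥(unitaryGroupOfForm (conjLocal L (IsCMField.complexConj L) v) (cmLocalForm L 3 v))} (hbM : b ∈ (cmBorelTriple L 3 v).M) {d : Fin 3 → (LocalRing L v)ˣ} (hd : glDiagonal 3 (LocalRing L v) d = (b : GL (Fin 3) (LocalRing L v)))
    (h01 : Valued.v ((((d 0 : (LocalRing L v)ˣ) : LocalRing L v) : LocalRing L v) w) < Valued.v ((((d 1 : (LocalRing L v)ˣ) : LocalRing L v) : LocalRing L v) w)) (h12 : Valued.v ((((d 1 : (LocalRing L v)ˣ) : LocalRing L v) : LocalRing L v) w) < Valued.v ((((d 2 : (LocalRing L v)ˣ) : LocalRing L v) : LocalRing L v) w)) :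
    haveI := locallyCompactSpace_cmBorelU L 3 v
    ∃ Ψ : ↥(cmBorelTriple L 3 v).M → ℂ, IsLocallyConstant Ψ ∧ HasCompactSupport Ψ ∧
      ∀ (t : ↥(cmBorelTriple L 3 v).M) (d' : Fin 3 → (LocalRing L v)ˣ)
      (hd' : glDiagonal 3 (LocalRing L v) d' = ((t : ↥(unitaryGroupOfForm (conjLocal L (IsCMField.complexConj L) v) (cmLocalForm L 3 v))) : GL (Fin 3) (LocalRing L v)))
      (ha' : IsUnit ((((d' 0)⁻¹ * d' 1 : (LocalRing L v)ˣ) : LocalRing L v) - 1))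
      (hb' : IsUnit ((((d' 0)⁻¹ * d' 2 : (LocalRing L v)ˣ) : LocalRing L v) - 1)),
      Ψ t =
          ((rootDeltaChar (cmBorelTriple L 3 v).P ⟨(t : ↥(unitaryGroupOfForm (conjLocal L (IsCMField.complexConj L) v) (cmLocalForm L 3 v))), (cmBorelTriple L 3 v).M_le t.2⟩ : ℂˣ) : ℂ) *
        (((letI : MeasurableSpace (LocalRing L v) := borel _; haveI : BorelSpace (LocalRing L v) := ⟨rfl⟩
          haveI : SecondCountableTopology (LocalRing L v) := secondCountableTopology_localRing (E := L) v
          ((distribHaarChar (LocalRing L v) ha'.unit)⁻¹ *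
            (HeisRing.skewModulus (conjLocal L (IsCMField.complexConj L) v) (continuous_conjLocal L (IsCMField.complexConj L) v) hb'.unit
              (HeisRing.map_unit_torusCentralScalar_sub_one (conjLocal L (IsCMField.complexConj L) v) (cmLocalForm_eq_over L 3 v) t hd' hb'))⁻¹ : ℝ≥0)) : ℝ) : ℂ)⁻¹ *
        classOrbitalIntegral mG ((DoubleCoset.doubleCoset b (K : Set ↥(unitaryGroupOfForm (conjLocal L (IsCMField.complexConj L) v) (cmLocalForm L 3 v))) (K : Set ↥(unitaryGroupOfForm (conjLocal L (IsCMField.complexConj L) v) (cmLocalForm L 3 v)))).indicator fun _ => (1 : ℂ)) (ConjClasses.mk ((t : ↥(unitaryGroupOfForm (conjLocal L (IsCMField.complexConj L) v) (cmLocalForm L 3 v))) : ((cmDatum L 3 (qsForm L)).Local v))) := by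
  haveI := locallyCompactSpace_cmBorelU L 3 v
  obtain ⟨Ψ, hlc, hK, hcl⟩ := exists_normalizedOrbitalIntegral_indicator_shell L w hw νG hmG K hKo hKc hr hKr hbM hd h01 h12
  refine ⟨Ψ, hlc, hK, fun t d' hd' ha' hb' => ?_⟩
  rw [hcl t d' hd' ha' hb', cmDatumLocalCongr_one_apply]

end Summit.HodgeConjecture.HodgeConjecture.Cruxes.H413.F0P3cStCharTSShellOrbitalG

end
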